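import Literature.MathematicalPhysics.QuantumFieldTheory.BalabanImbrieJaffe1984to88.BIJ88Sect2Statements
import Literature.MathematicalPhysics.QuantumFieldTheory.BalabanImbrieJaffe1984to88.BIJ85Sect2SurfaceAverages
import Literature.MathematicalPhysics.QuantumFieldTheory.BalabanImbrieJaffe1984to88.BIJ85CellAverages

/-!
# `BalabanImbrieJaffe1984to88.BIJ88Eq211Proof` — T. Bałaban, J. Imbrie, A. Jaffe, *Effective action and cluster properties
of the abelian Higgs model*, Commun. Math. Phys. **114** (1988) 257–315 [BalabanImbrieJaffe1988]: (2.11) p. 261 — the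
axial-gauge constraint of the localized covariance `C^{(k)}_{loc} = (I − Q^{s*}Q)C̃^{(k)}(I − Q*Q^s)` ((2.9)),
`Σ_{b∈Γ_{y,x}} C^{(k)}_{loc}(b,b₀) = Σ_{b∈Γ_{y,x}} C^{(k)}_{loc}(b₀,b) = 0`, PROVED as kernel algebra

statement-level skeleton of published theorems with citation tags; proofs where landed; nothing here is a claim about the Yang–Mills mass gap

PDF held: `paper:balaban1988-cmp114-bij-abelian-higgs-effective-action` (journal page = PDF page + 256); p. 261 [PDF 5] re-read AS
AN IMAGE this session (`HOME/lit-balaban-r16/renders/cmp114/original-p005-x2.png`); [2] = [BalabanImbrieJaffe1985] Chap. 2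
pp. 303–305 (`paper:balaban1985-cmp97-bij-higgs-minimizers`, text layer) for the axial gauge and Q^s, Q^{s*}.

WHAT IS REPRODUCED.  SKELETON row **C2.Eq2.11** (cell `lit-balaban`, HOME `run/shared/lean/pub/lit-balaban/`; Phase-2 seat p02
gen 2 = unit `lit-balaban-p02`, a G.2(b) knitting identity taken after the seat's B6 rows (2.36), (2.91); C2 §§1–4 fold owner
r18, carrier owner r15, referee ref-5; TAKING line HOME/STATUS.md 2026-08-21T03:40:08Z).  Before this file (2.11) was the
`def … : Prop` `BIJ88Sect2Statements.Eq211` only (typed p239939).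
p. 261, verbatim: *"Next we consider C^{(k)}, the covariance of the k-th step gauge field. This is defined on the unit lattice
T^{(k)}_{0,1}. First define C̃^{(k)}(b₁,b₂) = C^{(k)}(b₁,b₂), if dist(b₁,b₂) ≦ ¼r(e_k), 0, otherwise, (2.8) and extend by
translation invariance to T₁^{(k)}. Then put C^{(k)}_{loc} = (I − Q^{s*}Q)C̃^{(k)}(I − Q*Q^s); (2.9) this insures that C^{(k)}_{loc},
like C^{(k)}, satisfies the constraints from the renormalization transformation and from the axial gauge conditions:
QC^{(k)}_{loc} = C^{(k)}_{loc}Q* = 0, (2.10) Σ_{b∈Γ_{y,x}} C^{(k)}_{loc}(b,b₀) = Σ_{b∈Γ_{y,x}} C^{(k)}_{loc}(b₀,b) = 0. (2.11) (See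
[2, Chap. 2] for definitions of the block averaging operators Q, Q^s, and Q^e.)"*  [2] p. 303: *"In axial gauge we choose h in
order to set u_b = 1 for every b which occurs in some Γ_{yx}. In other words, we specify a maximal tree T(y) in each block B(y)
composed of bonds in any Γ_{yx}, x ∈ B(y)."*; [2] (2.15)–(2.17) p. 304: *"B^s(b′) = {b : b = (b₋,b₊), b₋ ∈ B(b′₋), b₊ ∈ B(b′₊)}
(2.15) … (Q^sA)_{b′} = L^{−(d−1)}Σ_{b∈B^s(b′)}A_b. (2.16) Then (Q^{s*}A)_b = LA_{b′} if b ∈ B^s(b′), 0, otherwise, (2.17)"*.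

WHAT IS PROVED HERE (0 `sorry`, standard axioms; kind «knitting identity» / model instance).
§1 KERNEL ALGEBRA (any finite bond types `β` (unit lattice) and `κ` (L-lattice), any real kernels).  `clocKer q qst qs qsst Ct`
= the kernel of (2.9), `(1 − Q^{s*}Q)·C̃·(1 − Q*Q^s)` as a product of rectangular matrices.  THE MECHANISM: the axial gauge is
`B_b = 0` on every tree bond ([2] p. 303), so the covariance `C^{(k)}` of the k-th step field — hence its truncation `C̃^{(k)}`
((2.8): `trunc_rows_zero`/`trunc_cols_zero`, truncation acts entrywise) — has VANISHING ROWS AND COLUMNS at the tree bonds;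
and by (2.17) `Q^{s*}` VANISHES ON INTERIOR BONDS (rows), `Q^s` ((2.16)) averages surface bonds only (columns).  Hence
(`clocKer_row_zero`, `clocKer_col_zero`) the rows and columns of `C^{(k)}_{loc}` at tree bonds vanish — the sandwich (2.9) does
not destroy the axial constraint — and **(2.11) holds termwise** for every family of axial contours `Γ_{y,x}` made of tree bonds
(`eq211_of_tree` : `BIJ88Sect2Statements.Eq211 Γ (clocKer …)`), for ANY block-average kernel `Q`, `Q*` (whose definition [2]
(2.13) does not enter).  (2.10) is r18's `BIJ88Sect2Statements.eq210_of` (needs `QQ^{s*} = I = Q^sQ*`) and is not redone.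
§2 THE TWO CARRIERS OF RECORD (G.5-1).  On r15's `BIJ85Sect2SurfaceAverages.BlockBonds` (explicit surface sets (2.15)): the
kernels `qsKer`/`qsstKer` ARE (2.16)/(2.17) (`Qs_eq_sum_qsKer`, `Qsstar_eq_sum_qsstKer`) and vanish on interior bonds
(`qsKer_interior`, `qsstKer_interior`, from `not_mem_Bs_of_interior`), so **`eq211_blockBonds`**: (2.11) for every kernel C̃
vanishing on the tree rows/columns and every contour family of interior bonds.  On p31's `BIJ85CellAverages.Cells` (m = 1,
`cell b = none` = interior): the same (`eq211_cells`).
§3 DICTIONARY to the ring-level typing `BIJ88Sect2Statements.cLoc` (one ring): with the operators embedded as block matrices on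
`β ⊕ κ` (`Matrix.fromBlocks`), the ββ-block of `cLoc Q Q* Q^s Q^{s*} C̃` IS `clocKer` (`cLoc_fromBlocks_toBlocks₁₁`).
HONEST SCOPE.  The content of δ_Ax for the k-th step covariance — "C^{(k)} vanishes on tree rows and columns" — and its
preservation by the translation-invariant extension of (2.8) (L-lattice translations map trees to trees) are the HYPOTHESES
`hrow`/`hcol`, stated as the print states the axial gauge; the reading T^{(k)}_{0,1} = a reference period of T₁^{(k)} is not
modelled.  Nothing on the estimates *"analogous to (2.5)–(2.7)"*, on 𝒟_{k,loc} (2.12)–(2.13), on d = 4 or the continuum;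
NOT summit progress.
-/

namespace Literature.MathematicalPhysics.QuantumFieldTheory.BalabanImbrieJaffe1984to88.BIJ88Eq211Proof

open Finset Matrix

/-! ## §1  The kernel of (2.9) and the axial constraint (2.11), for arbitrary kernels -/

section Kernel

variable {β κ : Type*} [Fintype β] [Fintype κ] [DecidableEq β]

/-- **(2.9) as a kernel**: `C_loc = (1 − Q^{s*}Q)·C̃·(1 − Q*Q^s)` with `Q : κ × β`, `Q* : β × κ`, `Q^s : κ × β`, `Q^{s*} : β × κ`,
`C̃ : β × β` real kernels (`β` = unit-lattice bonds of T₁^{(k)}, `κ` = L-lattice bonds). [cite: BalabanImbrieJaffe1988, (2.9) p.261] -/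
def clocKer (q : Matrix κ β ℝ) (qst : Matrix β κ ℝ) (qs : Matrix κ β ℝ) (qsst : Matrix β κ ℝ) (Ct : Matrix β β ℝ) :
    Matrix β β ℝ :=
  (1 - qsst * q) * Ct * (1 - qst * qs)

omit [Fintype β] in
/-- A row of `1 − Q^{s*}Q` at a bond where `Q^{s*}` vanishes is the unit row: `(1 − Q^{s*}Q)(b,b₁) = δ_{b b₁}`.
[cite: BalabanImbrieJaffe1985, (2.17) p.304] -/
theorem one_sub_left_row {qsst : Matrix β κ ℝ} (q : Matrix κ β ℝ) {b : β} (hb : ∀ c, qsst b c = 0) (b₁ : β) :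
    ((1 : Matrix β β ℝ) - qsst * q) b b₁ = (1 : Matrix β β ℝ) b b₁ := by
  rw [Matrix.sub_apply, Matrix.mul_apply]
  simp [hb]

omit [Fintype β] in
/-- A column of `1 − Q*Q^s` at a bond where `Q^s` vanishes is the unit column: `(1 − Q*Q^s)(b₂,b) = δ_{b₂ b}`.
[cite: BalabanImbrieJaffe1985, (2.16) p.304] -/
theorem one_sub_right_col {qs : Matrix κ β ℝ} (qst : Matrix β κ ℝ) {b : β} (hb : ∀ c, qs c b = 0) (b₂ : β) :
    ((1 : Matrix β β ℝ) - qst * qs) b₂ b = (1 : Matrix β β ℝ) b₂ b := by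
  rw [Matrix.sub_apply, Matrix.mul_apply]
  simp [hb]

/-- **Tree rows of `C^{(k)}_{loc}` vanish**: if `C̃(b,·) = 0` (axial gauge: B_b = 0 on the tree bond b, so the covariance row
vanishes) and `Q^{s*}(b,·) = 0` (b interior, (2.17)), then `C_loc(b,b₀) = 0` for every b₀. [cite: BalabanImbrieJaffe1988, (2.11) p.261] -/
theorem clocKer_row_zero (q : Matrix κ β ℝ) (qst : Matrix β κ ℝ) (qs : Matrix κ β ℝ) {qsst : Matrix β κ ℝ}
    {Ct : Matrix β β ℝ} {b : β} (hrow : ∀ b', Ct b b' = 0) (hqsst : ∀ c, qsst b c = 0) (b₀ : β) :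
    clocKer q qst qs qsst Ct b b₀ = 0 := by
  have h1 : ∀ b₂, (((1 : Matrix β β ℝ) - qsst * q) * Ct) b b₂ = 0 := by
    intro b₂
    rw [Matrix.mul_apply]
    refine Finset.sum_eq_zero fun b₁ _ => ?_
    rw [one_sub_left_row q hqsst, Matrix.one_apply]
    split_ifs with h
    · subst h; rw [hrow, mul_zero]
    · rw [zero_mul]
  unfold clocKer
  rw [Matrix.mul_apply]
  exact Finset.sum_eq_zero fun b₂ _ => by rw [h1, zero_mul]

/-- **Tree columns of `C^{(k)}_{loc}` vanish**: if `C̃(·,b) = 0` and `Q^s(·,b) = 0` (b interior, (2.16)), then `C_loc(b₀,b) = 0`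
for every b₀. [cite: BalabanImbrieJaffe1988, (2.11) p.261] -/
theorem clocKer_col_zero (q : Matrix κ β ℝ) {qst : Matrix β κ ℝ} {qs : Matrix κ β ℝ} (qsst : Matrix β κ ℝ)
    {Ct : Matrix β β ℝ} {b : β} (hcol : ∀ b', Ct b' b = 0) (hqs : ∀ c, qs c b = 0) (b₀ : β) :
    clocKer q qst qs qsst Ct b₀ b = 0 := by
  unfold clocKer
  rw [Matrix.mul_apply]
  refine Finset.sum_eq_zero fun b₂ _ => ?_
  rw [one_sub_right_col qst hqs, Matrix.one_apply]
  split_ifs with h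
  · subst h
    rw [Matrix.mul_apply, Finset.sum_eq_zero fun b₁ _ => by rw [hcol, mul_zero], zero_mul]
  · rw [mul_zero]

/-- **(2.11) PROVED** (termwise): for a family of axial contours `Γ i` (= Γ_{y,x}) consisting of tree bonds (`hΓ`), a kernel
`C̃` with vanishing tree rows and columns (the axial constraint of C^{(k)}, inherited through (2.8)), `Q^{s*}` vanishing on tree
rows and `Q^s` on tree columns ((2.16)–(2.17): tree bonds are interior), and ANY `Q`, `Q*`:
`Σ_{b∈Γ_{y,x}} C_loc(b,b₀) = Σ_{b∈Γ_{y,x}} C_loc(b₀,b) = 0`. [cite: BalabanImbrieJaffe1988, (2.11) p.261] -/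
theorem eq211_of_tree {ι : Type*} (Γ : ι → Finset β) (T : Set β) (hΓ : ∀ i, ∀ b ∈ Γ i, b ∈ T)
    (q : Matrix κ β ℝ) (qst : Matrix β κ ℝ) (qs : Matrix κ β ℝ) (qsst : Matrix β κ ℝ) (Ct : Matrix β β ℝ)
    (hrow : ∀ b ∈ T, ∀ b', Ct b b' = 0) (hcol : ∀ b ∈ T, ∀ b', Ct b' b = 0)
    (hqsst : ∀ b ∈ T, ∀ c, qsst b c = 0) (hqs : ∀ b ∈ T, ∀ c, qs c b = 0) :
    BIJ88Sect2Statements.Eq211 Γ (fun b b' => clocKer q qst qs qsst Ct b b') := by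
  intro i b₀
  constructor
  · exact Finset.sum_eq_zero fun b hb =>
      clocKer_row_zero q qst qs (hrow b (hΓ i b hb)) (hqsst b (hΓ i b hb)) b₀
  · exact Finset.sum_eq_zero fun b hb =>
      clocKer_col_zero q qsst (hcol b (hΓ i b hb)) (hqs b (hΓ i b hb)) b₀

omit [Fintype β] [DecidableEq β] in
/-- **(2.8) preserves the axial constraint, rows**: a truncation `C̃ = trunc dist R C` has vanishing rows wherever `C` has.
[cite: BalabanImbrieJaffe1988, (2.8) p.261] -/
theorem trunc_rows_zero {dist : β → β → ℝ} {R : ℝ} {C : β → β → ℝ} {b : β} (h : ∀ b', C b b' = 0) (b' : β) :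
    BIJ88Sect2Statements.trunc dist R C b b' = 0 := by
  simp [BIJ88Sect2Statements.trunc, h b']

omit [Fintype β] [DecidableEq β] in
/-- **(2.8) preserves the axial constraint, columns**. [cite: BalabanImbrieJaffe1988, (2.8) p.261] -/
theorem trunc_cols_zero {dist : β → β → ℝ} {R : ℝ} {C : β → β → ℝ} {b : β} (h : ∀ b', C b' b = 0) (b' : β) :
    BIJ88Sect2Statements.trunc dist R C b' b = 0 := by
  simp [BIJ88Sect2Statements.trunc, h b']

/-- (2.11) with C̃ = the truncation (2.8) of a kernel C carrying the axial constraint. [cite: BalabanImbrieJaffe1988, (2.8)–(2.11) p.261] -/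
theorem eq211_of_tree_trunc {ι : Type*} (Γ : ι → Finset β) (T : Set β) (hΓ : ∀ i, ∀ b ∈ Γ i, b ∈ T)
    (q : Matrix κ β ℝ) (qst : Matrix β κ ℝ) (qs : Matrix κ β ℝ) (qsst : Matrix β κ ℝ)
    (dist : β → β → ℝ) (R : ℝ) (C : β → β → ℝ)
    (hrow : ∀ b ∈ T, ∀ b', C b b' = 0) (hcol : ∀ b ∈ T, ∀ b', C b' b = 0)
    (hqsst : ∀ b ∈ T, ∀ c, qsst b c = 0) (hqs : ∀ b ∈ T, ∀ c, qs c b = 0) :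
    BIJ88Sect2Statements.Eq211 Γ
      (fun b b' => clocKer q qst qs qsst (Matrix.of (BIJ88Sect2Statements.trunc dist R C)) b b') :=
  eq211_of_tree Γ T hΓ q qst qs qsst _
    (fun b hb b' => by rw [Matrix.of_apply]; exact trunc_rows_zero (hrow b hb) b')
    (fun b hb b' => by rw [Matrix.of_apply]; exact trunc_cols_zero (hcol b hb) b') hqsst hqs

end Kernel

/-! ## §2  The carriers of record: r15's `BlockBonds` (explicit surface sets) and p31's `Cells` -/

section BlockBonds

open BIJ85Sect2SurfaceAverages

variable (G : BlockBonds)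

/-- The kernel of `Q^s` (2.16): `L^{−(d−1)}·1[b ∈ B^s(b′)]`. [cite: BalabanImbrieJaffe1985, (2.16) p.304] -/
noncomputable def qsKer : Matrix G.CB G.FB ℝ := fun c b => if b ∈ G.Bs c then ((G.L : ℝ) ^ (G.d - 1))⁻¹ else 0

/-- The kernel of `Q^{s*}` (2.17): `L·1[b ∈ B^s(b′)]`. [cite: BalabanImbrieJaffe1985, (2.17) p.304] -/
noncomputable def qsstKer : Matrix G.FB G.CB ℝ := fun b c => if b ∈ G.Bs c then (G.L : ℝ) else 0

/-- `qsKer` IS the kernel of r15's `Qs`: `(Q^sA)_{b′} = Σ_b qsKer(b′,b) A_b`. [cite: BalabanImbrieJaffe1985, (2.16) p.304] -/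
theorem Qs_eq_sum_qsKer (A : G.FB → ℝ) (c : G.CB) : G.Qs A c = ∑ b, qsKer G c b * A b := by
  unfold BlockBonds.Qs qsKer
  rw [Finset.mul_sum, ← Finset.sum_filter_add_sum_filter_not Finset.univ (fun b => b ∈ G.Bs c)]
  have h0 : ∑ b ∈ Finset.univ.filter (fun b => ¬ b ∈ G.Bs c),
      (if b ∈ G.Bs c then ((G.L : ℝ) ^ (G.d - 1))⁻¹ else 0) * A b = 0 :=
    Finset.sum_eq_zero fun b hb => by rw [if_neg (Finset.mem_filter.1 hb).2, zero_mul]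
  rw [h0, add_zero, Finset.filter_mem_eq_inter, Finset.univ_inter]
  exact Finset.sum_congr rfl fun b hb => by rw [if_pos hb]

/-- `qsstKer` IS the kernel of r15's `Qsstar`: `(Q^{s*}B)_b = Σ_{b′} qsstKer(b,b′) B_{b′}`. [cite: BalabanImbrieJaffe1985, (2.17) p.304] -/
theorem Qsstar_eq_sum_qsstKer (B : G.CB → ℝ) (b : G.FB) : G.Qsstar B b = ∑ c, qsstKer G b c * B c := by
  unfold BlockBonds.Qsstar qsstKer
  exact Finset.sum_congr rfl fun c _ => by split_ifs <;> simp

/-- (2.16) sees surface bonds only: the `Q^s`-kernel vanishes at every interior bond (both endpoints in one block).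
[cite: BalabanImbrieJaffe1985, (2.16) p.304] -/
theorem qsKer_interior {b : G.FB} (hb : G.blk (G.src b) = G.blk (G.tgt b)) (c : G.CB) : qsKer G c b = 0 := by
  simp [qsKer, G.not_mem_Bs_of_interior hb c]

/-- (2.17), second case: the `Q^{s*}`-kernel vanishes at every interior bond. [cite: BalabanImbrieJaffe1985, (2.17) p.304] -/
theorem qsstKer_interior {b : G.FB} (hb : G.blk (G.src b) = G.blk (G.tgt b)) (c : G.CB) : qsstKer G b c = 0 := by
  simp [qsstKer, G.not_mem_Bs_of_interior hb c]

/-- **(2.11) ON THE SURFACE-BOND CARRIER**: for every axial-contour family of INTERIOR bonds (the trees T(y) ⊂ B(y) of [2]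
p. 303), every kernel C̃ whose rows and columns vanish on these bonds, and every `Q`, `Q*`, the localized covariance (2.9) built
with the printed `Q^s` (2.16), `Q^{s*}` (2.17) satisfies `Σ_{b∈Γ_{y,x}} C_loc(b,b₀) = Σ_{b∈Γ_{y,x}} C_loc(b₀,b) = 0`.
[cite: BalabanImbrieJaffe1988, (2.11) p.261] -/
theorem eq211_blockBonds {ι : Type*} (Γ : ι → Finset G.FB)
    (hΓ : ∀ i, ∀ b ∈ Γ i, G.blk (G.src b) = G.blk (G.tgt b))
    (q : Matrix G.CB G.FB ℝ) (qst : Matrix G.FB G.CB ℝ) (Ct : Matrix G.FB G.FB ℝ)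
    (hrow : ∀ b, G.blk (G.src b) = G.blk (G.tgt b) → ∀ b', Ct b b' = 0)
    (hcol : ∀ b, G.blk (G.src b) = G.blk (G.tgt b) → ∀ b', Ct b' b = 0) :
    BIJ88Sect2Statements.Eq211 Γ (fun b b' => clocKer q qst (qsKer G) (qsstKer G) Ct b b') :=
  eq211_of_tree Γ {b | G.blk (G.src b) = G.blk (G.tgt b)} hΓ q qst (qsKer G) (qsstKer G) Ct hrow hcol
    (fun _ hb c => qsstKer_interior G hb c) (fun _ hb c => qsKer_interior G hb c)

end BlockBonds

section Cells

open BIJ85CellAverages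

variable (G : Cells)

/-- On the `Cells` carrier (interior cells = `cell b = none`): the kernel of `Qstar` ((2.17)/(2.22)), `L^m·1[b ∈ B(c)]`.
[cite: BalabanImbrieJaffe1985, (2.17) p.304] -/
noncomputable def cqsstKer : Matrix G.F G.C ℝ := fun b c => if b ∈ G.B c then (G.L : ℝ) ^ G.m else 0

/-- On the `Cells` carrier: the kernel of `Q` ((2.16)/(2.21)), `L^{−(d−m)}·1[b ∈ B(c)]`. [cite: BalabanImbrieJaffe1985, (2.16) p.304] -/
noncomputable def cqsKer : Matrix G.C G.F ℝ := fun c b => if b ∈ G.B c then ((G.L : ℝ) ^ (G.d - G.m))⁻¹ else 0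

/-- `cqsstKer` IS the kernel of `Cells.Qstar`. [cite: BalabanImbrieJaffe1985, (2.17) p.304] -/
theorem cQstar_eq_sum (g : G.C → ℝ) (b : G.F) : G.Qstar g b = ∑ c, cqsstKer G b c * g c := by
  unfold Cells.Qstar cqsstKer
  exact Finset.sum_congr rfl fun c _ => by split_ifs <;> simp

/-- `cqsKer` IS the kernel of `Cells.Q`. [cite: BalabanImbrieJaffe1985, (2.16) p.304] -/
theorem cQ_eq_sum (f : G.F → ℝ) (c : G.C) : G.Q f c = ∑ b, cqsKer G c b * f b := by
  unfold Cells.Q cqsKer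
  rw [Finset.mul_sum, ← Finset.sum_filter_add_sum_filter_not Finset.univ (fun b => b ∈ G.B c)]
  have h0 : ∑ b ∈ Finset.univ.filter (fun b => ¬ b ∈ G.B c),
      (if b ∈ G.B c then ((G.L : ℝ) ^ (G.d - G.m))⁻¹ else 0) * f b = 0 :=
    Finset.sum_eq_zero fun b hb => by rw [if_neg (Finset.mem_filter.1 hb).2, zero_mul]
  rw [h0, add_zero, Finset.filter_mem_eq_inter, Finset.univ_inter]
  exact Finset.sum_congr rfl fun b hb => by rw [if_pos hb]

/-- An interior cell (`cell b = none`) lies in no block set. [cite: BalabanImbrieJaffe1985, (2.15) p.304] -/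
theorem not_mem_B_of_none {b : G.F} (hb : G.cell b = none) (c : G.C) : b ∉ G.B c := by
  rw [Cells.mem_B, hb]
  exact fun h => Option.some_ne_none c h.symm

/-- **(2.11) ON THE `Cells` CARRIER** (m = 1: surface averages; interior bonds = `cell b = none`), same hypotheses as
`eq211_blockBonds`. [cite: BalabanImbrieJaffe1988, (2.11) p.261] -/
theorem eq211_cells {ι : Type*} (Γ : ι → Finset G.F) (hΓ : ∀ i, ∀ b ∈ Γ i, G.cell b = none)
    (q : Matrix G.C G.F ℝ) (qst : Matrix G.F G.C ℝ) (Ct : Matrix G.F G.F ℝ)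
    (hrow : ∀ b, G.cell b = none → ∀ b', Ct b b' = 0) (hcol : ∀ b, G.cell b = none → ∀ b', Ct b' b = 0) :
    BIJ88Sect2Statements.Eq211 Γ (fun b b' => clocKer q qst (cqsKer G) (cqsstKer G) Ct b b') :=
  eq211_of_tree Γ {b | G.cell b = none} hΓ q qst (cqsKer G) (cqsstKer G) Ct hrow hcol
    (fun _ hb c => by simp [cqsstKer, not_mem_B_of_none G hb c])
    (fun _ hb c => by simp [cqsKer, not_mem_B_of_none G hb c])

end Cells

/-! ## §3  Dictionary to the ring-level typing `BIJ88Sect2Statements.cLoc` -/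

section Blocks

variable {β κ : Type*} [Fintype β] [Fintype κ] [DecidableEq β] [DecidableEq κ]

/-- Embedding a `β × κ` kernel (unit bonds ← L-bonds, e.g. `Q^{s*}`, `Q*`) into the ring of square matrices on `β ⊕ κ`.
[cite: BalabanImbrieJaffe1988, (2.9) p.261] -/
def embUL (M : Matrix β κ ℝ) : Matrix (β ⊕ κ) (β ⊕ κ) ℝ := Matrix.fromBlocks 0 M 0 0

/-- Embedding a `κ × β` kernel (L-bonds ← unit bonds, e.g. `Q`, `Q^s`). [cite: BalabanImbrieJaffe1988, (2.9) p.261] -/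
def embLU (M : Matrix κ β ℝ) : Matrix (β ⊕ κ) (β ⊕ κ) ℝ := Matrix.fromBlocks 0 0 M 0

/-- Embedding a `β × β` kernel (e.g. `C̃`). [cite: BalabanImbrieJaffe1988, (2.9) p.261] -/
def embUU (M : Matrix β β ℝ) : Matrix (β ⊕ κ) (β ⊕ κ) ℝ := Matrix.fromBlocks M 0 0 0

/-- **The ring-level (2.9) IS the kernel (2.9)**: in the ring `Matrix (β ⊕ κ) (β ⊕ κ) ℝ`, with `Q`, `Q*`, `Q^s`, `Q^{s*}`, `C̃`
embedded as blocks, the unit-bond block of r18's `cLoc Q Q* Q^s Q^{s*} C̃ = (1 − Q^{s*}Q)C̃(1 − Q*Q^s)` is `clocKer`.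
[cite: BalabanImbrieJaffe1988, (2.9) p.261] -/
theorem cLoc_fromBlocks_toBlocks₁₁ (q : Matrix κ β ℝ) (qst : Matrix β κ ℝ) (qs : Matrix κ β ℝ) (qsst : Matrix β κ ℝ)
    (Ct : Matrix β β ℝ) :
    (BIJ88Sect2Statements.cLoc (embLU q) (embUL qst) (embLU qs) (embUL qsst) (embUU Ct)).toBlocks₁₁
      = clocKer q qst qs qsst Ct := by
  have hprod : ∀ (M : Matrix β κ ℝ) (N : Matrix κ β ℝ),
      embUL M * embLU N = Matrix.fromBlocks (M * N) 0 0 (0 : Matrix κ κ ℝ) := by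
    intro M N
    simp [embUL, embLU, Matrix.fromBlocks_multiply]
  have hsub : ∀ A : Matrix β β ℝ, (1 : Matrix (β ⊕ κ) (β ⊕ κ) ℝ) - Matrix.fromBlocks A 0 0 (0 : Matrix κ κ ℝ)
      = Matrix.fromBlocks (1 - A) 0 0 1 := by
    intro A
    rw [← Matrix.fromBlocks_one, sub_eq_add_neg, Matrix.fromBlocks_neg, Matrix.fromBlocks_add]
    simp [sub_eq_add_neg]
  unfold BIJ88Sect2Statements.cLoc clocKer
  rw [hprod, hprod, hsub, hsub]
  simp [embUU, Matrix.fromBlocks_multiply]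

end Blocks

end Literature.MathematicalPhysics.QuantumFieldTheory.BalabanImbrieJaffe1984to88.BIJ88Eq211Proof
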